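import Literature.MathematicalPhysics.QuantumFieldTheory.Balaban1983to89.T4TermwiseTorus
import Literature.MathematicalPhysics.QuantumFieldTheory.Balaban1983to89.B7Prop2Explicit
import Mathlib.Analysis.Matrix.Spectrum

/-!
# T⁴ continuum, node U5 (NE7), TERM-WISE member — (id-V) + (wt) FOR `G ⊂ U(N)`, EVERY `N ≥ 1`: the real
# inner-product space `V = u(N)` with Bałaban's scalar product (17), the `1`-Lipschitz skew-hermitian part
# `π : (M_N(ℂ), |·|) → u(N)`, and the Wilson weight `e(X) = 1 − Re tr e^X` with `‖X‖²/2 − (N/24)‖X‖⁴ ≤ e(X) ≤ ‖X‖²/2`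

Lineage t4-ne7-p1 (term-wise matching modulo constants), generation 13.  HONEST FRAMING (page 1): pure YM₄ on a FIXED
FINITE torus T⁴, rung (B)+1 of the cell's ladder = the `ε → 0` limit of expectations of gauge-invariant observables; NOT
infinite volume, NOT a mass gap, NOT the Clay problem.  Spine estimate NE7 (node U5) is NOT PRINTED for Bałaban's d = 4
procedure and is NOT proved here.  The conditionals of the lineage — the flow window (0.31) of [Balaban1987RG1] (the cell's
BetaPertH road; tree `Step.Discrete031`, the binders `h031A`/`h031B` of generation 10's capstone
`T4TermwiseQuartic.goodClause_summable_of_kindsRA_regular`), (B), (B^μ) — are untouched by this leaf: they sit BY NAME where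
they are declared and inside the producers of the capstone's other binders; nothing here discharges or hides them.  This
leaf is LINEAR ALGEBRA over `M_N(ℂ)` (the spectral theorem for hermitian matrices and `Tr AB = Tr BA`, Mathlib) and a
re-indexing of the tree's kernel theorems (`T4TermwiseTorus.bch_torus` / `norm_textend` / `osc_support` / `pker_sum_eq`,
`B7Prop2Explicit.bavg_mem_unitaryUnits` / `star_mlog_eq_neg` / `unitaryUnits_le_U1` / `norm_Wcx_sub_one_le`,
`B7Prop1Explicit.prop1_explicit`, `MatrixNorms.nhsNorm_le_opNorm`, `MatrixLog.exp_mlog` / `norm_mlog_le_two_mul`,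
`T4TermwiseQuartic.one_sub_cos_sandwich` — all reached BY NAME, nothing upstream edited): no new estimate of the papers, no
`sorry`, eleven bookkeeping definitions (`HS`, `mat`, `toHS`, `skewPartM`, `uN`, `piU`, `eN`, `phiM`, `GM`,
`phiU`/`psiU`/`PhiU`), every statement [folklore] or a re-indexing.

CITATION HEADER (lean-in-tree rule 2026-08-18).  Audit cell `pub-balaban`, sub-cell t4 (unit b2b-balaban-t4-ne7-p1-g13).
Sources.  T. Bałaban, *Averaging operations for lattice gauge theories*, Commun. Math. Phys. **98**, 17–51 (1985)
[Balaban1985Averaging] (cell paper B7).  THIS LEAF ADDS NO NEW QUOTATION OF PRINT: it uses exactly the displays already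
quoted VERBATIM from the page renders in the citation headers of tree modules of the cell, namely — p. 18 «Gauge field
configurations U are defined on a set of bonds in Ω, and with values in a Lie subgroup G of a unitary group U(N).» and
p. 18 (7) «U(x, x′) = U⁻¹(x′, x) = U*(x′, x)» (header of `T4TermwiseSU2`); (17) p. 20, the scalar product
`⟨X, Y⟩ = tr X*Y` on `M_N(ℂ)` with the NORMALIZED trace `tr X = (1/N) Σ_j X_jj`, p. 21 «for a matrix X the norm is given
by ‖X‖² = tr X*X», (19) p. 21 the operator norm `|X|`, and (20) p. 21 «We have the following inequalities for the norms
introduced: |tr X| ≤ |X|, ‖X‖ ≤ |X|, |X| ≤ √N ‖X‖, |XY| ≤ |X| |Y|, ‖XY‖ ≤ ‖X‖ ‖Y‖.» (header of `MatrixNorms`, which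
also certifies that the last member is false as printed — not used here); (21) p. 21 the logarithmic series, (22)–(23)
p. 21 «… and then we define log U = i Σ_j λ_j P_j = iA, (23) A is a hermitian matrix, |A| ≤ π» and (26) p. 22
«|log X| ≤ Σ_{n=1}^∞ (1/n)|X − 1|^n ≤ |X − 1|/(1 − |X − 1|) ≤ 2|X − 1|» (header of `MatrixLog`); p. 23 «Let U be a gauge
field configuration with values in U(N). The one-step averaging operation is defined by …» (42) (header of
`B7Prop2Explicit`); Proposition 1 (51) p. 26 (header of `B7Prop1Explicit`).  T. Bałaban, *Renormalization group approach
to lattice gauge field theories. I*, Commun. Math. Phys. **109**, 249–301 (1987) [Balaban1987RG1] (B12): (0.2) p. 252 the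
Wilson action `Σ_p ε^{d−4}[1 − Re tr U(∂p)]`, `Re tr = Re Tr / N`, as transcribed (not quoted) in the cell's
`Setup.wilsonAction` / `UnitaryModel.nReTr`; (0.1) p. 251 the torus, as cited by `T4TermwiseTorus`.  Nothing else of the
papers is used; `|·|` below is the operator norm (19) = Mathlib's `L²`-operator norm (scope `Matrix.Norms.L2Operator`), `‖·‖`
on `HS n` / `uN n` is the `L²` norm of (17) = `MatrixNorms.nhsNorm`.

## Why this leaf (record `t4/T4-EST-NE7-P1.md` v17 §16: (16c) «no ℝ-linear isometry su(N) → (M_N(ℂ), |·|) for N ≥ 3 —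
## (id-V) costs constants there» and (16d)(vi)/(16m)(v) «generation 13: V = u(N) with the scalar product (17), weight with
## q₄ = N/24» — the record's words, not print)
Generation 10's `T4TermwiseQuartic.interpolation_averaging_of_regular` is stated over an abstract real inner-product space `V`
(fields `φA ψA ΦA` valued in `V`, a weight `e : V → ℝ` with `he : ‖v‖²/2 − q₄‖v‖⁴ ≤ e v ≤ ‖v‖²/2` for ALL `v`), while
generations 11–12 proved (bch)/(tr) with values in the Banach algebra `𝔸 = (M_N(ℂ), |·|)` of the bond variables and closed
the identification (id-V) for `SU(2)` only, through the quaternion ISOMETRY (`T4TermwiseSU2`).  For `N ≥ 3` no isometry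
exists — but generation 10 needs none.  It uses `V` in exactly four ways, and each is met by `V = u(N)` (skew-hermitian
matrices, (22)–(23)) with the norm of (17) and the real-linear skew-hermitian part `π X = ½(X − X*)` read in `V`:
* (bch) `hρ` and (sz) `hs` are UPPER BOUNDS on norms of real-linear expressions in the logarithms — they push forward along
  any real-linear map of norm `≤ 1`, and `‖π X‖ ≤ ‖X‖ ≤ |X|` by (20) (`norm_piU_sub_sum_le`, `bch_torus_piU`; no constant);
* (tr) `hΦ` is a norm EQUALITY `‖Φ(p′, x)‖ = ‖φ(x)‖` between a transported logarithm `W (log V(∂p)) W⁻¹` and `log V(∂p)`;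
  the transporters are products of bond variables, hence unitary ((7)), unitary conjugation is an isometry of the norm (17)
  (`Tr AB = Tr BA`) and commutes with `π` (`norm_piU_units_conj`, `norm_piU_textend_transport`; no constant, no smallness);
* (wt) `he` must hold on ALL of `V`, which forces `V` to consist of normal matrices (on a nilpotent `X ≠ 0`,
  `1 − Re tr e^X = 0`): `V = u(N)`, where by the spectral theorem (eigenvalues `−iθ_a`) `e(X) := 1 − Re tr e^X =
  (1/N) Σ_a (1 − cos θ_a)` and `‖X‖² = (1/N) Σ_a θ_a²`, so the scalar sandwich `x²/2 − x⁴/24 ≤ 1 − cos x ≤ x²/2` and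
  `Σ θ⁴ ≤ (Σ θ²)² = N²‖X‖⁴` give `he` with `q₄ = N/24` (`eN_sandwich`) — the ONLY constant (id-V) costs, optimal for this
  norm (one eigenvalue `θ`, the others `0`), and the normalisation `tr = Tr/N` of (17) is exactly the one for which the
  quadratic term is `‖X‖²/2`, generation 10's shape;
* (repr) the Wilson terms: `1 − Re tr U = e(π (log U))` for unitary `U` with `|U − 1| ≤ 1/4` ((22)–(23): `log U` is
  skew-hermitian, so `π` is the identity on it; `e^{log U} = U`) (`wilson_eq_eN`).
So the (16c) wall is sidestepped rather than climbed, uniformly in `N`, for `U(N)`-valued configurations — hence for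
configurations with values in ANY subgroup `G ⊂ U(N)` (e.g. `SU(N)`: `B7Prop2SpecialUnitary.specialUnitaryUnits_le_unitaryUnits`),
the hypotheses below asking only `V x κ ∈ unitaryUnits`.  For `SU(2)` this re-derives generation 12's binders with the
cruder `q₄ = 1/12` instead of `1/24` (the quaternion leaf stays the sharper statement there).

## What this module adds (additive leaf; imports `T4TermwiseTorus`, `B7Prop2Explicit`, Mathlib's matrix spectral theorem)
§1 `HS n` (type synonym of `Matrix n n ℂ` carrying (17)), `mat`/`toHS`, `inner_def`, `inner_self_eq`, the instances
   `NormedAddCommGroup`/`InnerProductSpace ℝ (HS n)` (via `InnerProductSpace.Core`), `norm_sq_eq`/`norm_eq` (`‖·‖ = nhsNorm`),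
   **`norm_toHS_le`** ((20) `‖X‖ ≤ |X|`), `trace_unitary_conj`, **`nhsNormSq_unitary_conj`**, `norm_toHS_unitary_conj`.
§2 `skewPartM` (+ `_conjTranspose`, `_of_skew`, `_add`, `_smul`, `_conj`), **`uN n : Submodule ℝ (HS n)`** (= `u(N)`, an
   inner-product space by Mathlib's `Submodule.innerProductSpace`), **`piU : Matrix n n ℂ →ₗ[ℝ] uN n`**, `coe_piU_of_skew`,
   `norm_piU_le_norm_toHS`, `norm_piU_of_skew`, `norm_piU_conj`, **`norm_piU_le`**, `norm_piU_sub_le`, **`norm_piU_sub_sum_le`**.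
§3 **`eN`**; `skew_frame`, `exp_frame`, `skew_spectral` (spectral calculus of a skew-hermitian matrix), `sum_pow_four_le`,
   **`weight_sandwich`**, **`eN_sandwich`** (= `he`, `q₄ = N/24`), `eN_nonneg`.
§4 `U1_of_U`, `hol_mem_U`, `axialFn_mem_U`, `cplaq_mem_U`, `val_inv_eq_star`, `norm_piU_units_conj`, **`mlog_skew`**
   ((22)–(23)), `smallness_unfold`, `norm_hol_sub_one_le`, **`bavg_mem_U`** ((42) of a `U(N)` field is `U(N)`-valued under (44) +
   Prop. 2 smallness), `norm_cplaq_bavg_sub_one_le` ((51)).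
§5 `piU_textend`, **`bch_torus_piU`** ((bch) = `hρA`/`hρB` in `u(N)`), **`norm_piU_textend_transport`** ((tr) = `hΦA`/`hΦB`
   in `u(N)`, every `x`, no smallness), `norm_piU_mlog_le` ((sz)), **`wilson_eq_eN`** ((repr), Wilson terms).
§6 plane-labelled packaging over `(Fin d × Fin d) × ℤ^d` (`T4TermwiseTorus.pbox`), mirroring `T4TermwiseSU2` §4: `phiM`,
   `GM`, **`phiU`/`psiU`/`PhiU`** (generation 10's `φA`/`ψA`/`ΦA` for `U(N)` as functions into `uN n`), **`norm_PhiU`**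
   (`hΦA`, ALL pairs), **`bch_PhiU`** (`hρA` with `Pf = pbox planes T`, `w = pker T L`), **`wilson_phiU_psiU`**
   (`hreprU`/`hreprL` terms), `norm_phiU_psiU_le` ((sz): `‖φ‖ ≤ 2α₀`, `‖ψ‖ ≤ 2(L²α₀ + 226θ²)`), `coe_phiU_eq`,
   `norm_PhiU_sub_le` ((osc) support).
§7 toys (non-vacuity for `U(3)`: the constant configuration `1` meets every hypothesis with `α₀ = 0`; `u(3)` is inhabited).

## Binder status for generation 10's `interpolation_averaging_of_regular`, `G ⊂ U(N)` (cumulative, gens 10–13)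
(ker) `hw hrow hcol`, (cnt) `hNf hNc`: PRODUCED (`T4TermwiseTorus.kernel_tower`, d = 4).  (tr) `hΦA hΦB`: PRODUCED in
`V = u(N)` for periodic `U(N)`-valued configurations, all pairs, every `N` (`norm_PhiU`).  (bch) `hρA hρB`: PRODUCED in
`V = u(N)` (`bch_PhiU`, `ρb = 280θ²`, `T ≥ 2L`, hypotheses (44) + Prop. 2 smallness of the periodic lift).  (id-V): PRODUCED
for every `N` (this leaf).  (wt) `he`, `hq₄`: PRODUCED (`eN_sandwich`, `q₄ = N/24 ≥ 0`).  Wilson terms of (repr):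
`wilson_phiU_psiU`.  ONE-CALL K-BOOKKEEPING for `U(N)`: as generation 12's `T4TermwiseInstantiate.interpolation_averaging_SU2`
with `V := uN n`, `e := eN`, `q₄ := N/24`, `φA K := phiU V_K`, `ψA K := psiU L V_K`, `ΦA K := PhiU (n_K L) L V_K` — not
typed in this leaf; its remaining inputs are the UNPRINTED ones.
UNCHANGED, still hypotheses upstream (BY NAME where they are declared): (osc-U) the rate-carrying oscillation bound — NOT
PRINTED as an inequality (locus [Balaban1985Variational] pp. 280–286); (W-w); the size law `hs`; (repr) = the
identification of runs A/B's effective actions with `Σ e(φ)`, `Σ e(ψ)` beyond the Wilson terms; (0.31) = `h031A`/`h031B`;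
(B); (B^μ).  No new end-to-end theorem is stated; NE7 remains NOT PRINTED and NOT PROVED.

## What is NOT delivered
The `U(N)` one-call instantiation and the oscillation packaging (the `U(N)` analogues of generation 12's
`T4TermwiseInstantiate` / `T4TermwiseOscillation` / `T4TermwiseChainSU2` — bookkeeping over this leaf); (osc-U); optimal
constants in (bch)/(sz); anything using more of the papers than the displays above.
-/

noncomputable section

open scoped BigOperators Matrix Matrix.Norms.L2Operator ComplexConjugate InnerProductSpace
open NormedSpace Finset
open Complex (I)

namespace Literature.MathematicalPhysics.QuantumFieldTheory.Balaban1983to89.T4TermwiseUN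

open B7Prop1Explicit B7Prop2Explicit T4TermwiseBCH T4TermwiseTorus MatrixNorms UnitaryModel

/-! ## §1 The real Hilbert space `(M_N(ℂ), ⟨X, Y⟩ = Re tr X⋆Y)` of B7 (17) -/

section HilbertSchmidt

variable {n : Type*}

/-- The real vector space `M_N(ℂ)` carrying Bałaban's scalar product (17) `⟨X, Y⟩ = tr X⋆Y` (normalised trace
`tr = Tr/N`, real part): a type synonym of `Matrix n n ℂ`, so that the operator norm (19) on `Matrix n n ℂ` and the
`L²` norm of (17) live on different types. [cite: Balaban1985Averaging, (17) p.20] -/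
def HS (n : Type*) : Type _ := Matrix n n ℂ

/-- The additive group of `HS n` is that of `Matrix n n ℂ`. [folklore] -/
instance : AddCommGroup (HS n) := inferInstanceAs (AddCommGroup (Matrix n n ℂ))

/-- The real vector-space structure of `HS n` is that of `Matrix n n ℂ` (restriction of scalars). [folklore] -/
instance : Module ℝ (HS n) := inferInstanceAs (Module ℝ (Matrix n n ℂ))

/-- `HS n` is inhabited by `0`. [folklore] -/
instance : Inhabited (HS n) := ⟨(0 : HS n)⟩

/-- The underlying matrix of a vector of `HS n`. [folklore] -/
def mat (v : HS n) : Matrix n n ℂ := v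

/-- A matrix read as a vector of `HS n`. [folklore] -/
def toHS (X : Matrix n n ℂ) : HS n := X

/-- `mat ∘ toHS = id`. [folklore] -/
@[simp] theorem mat_toHS (X : Matrix n n ℂ) : mat (toHS X) = X := rfl

/-- `toHS ∘ mat = id`. [folklore] -/
@[simp] theorem toHS_mat (v : HS n) : toHS (mat v) = v := rfl

/-- `mat` is injective. [folklore] -/
theorem mat_injective : Function.Injective (mat : HS n → Matrix n n ℂ) := fun _ _ h => h

/-- `mat` is additive. [folklore] -/
theorem mat_add (v w : HS n) : mat (v + w) = mat v + mat w := rfl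

/-- `mat` respects subtraction. [folklore] -/
theorem mat_sub (v w : HS n) : mat (v - w) = mat v - mat w := rfl

/-- `mat` respects negation. [folklore] -/
theorem mat_neg (v : HS n) : mat (-v) = -mat v := rfl

/-- `mat` is real-homogeneous. [folklore] -/
theorem mat_smul (r : ℝ) (v : HS n) : mat (r • v) = r • mat v := rfl

/-- `mat 0 = 0`. [folklore] -/
theorem mat_zero : mat (0 : HS n) = 0 := rfl

/-- `toHS` is additive. [folklore] -/
theorem toHS_add (X Y : Matrix n n ℂ) : toHS (X + Y) = toHS X + toHS Y := rfl

/-- `toHS` respects subtraction. [folklore] -/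
theorem toHS_sub (X Y : Matrix n n ℂ) : toHS (X - Y) = toHS X - toHS Y := rfl

/-- `toHS` is real-homogeneous. [folklore] -/
theorem toHS_smul (r : ℝ) (X : Matrix n n ℂ) : toHS (r • X) = r • toHS X := rfl

/-- `toHS 0 = 0`. [folklore] -/
theorem toHS_zero : toHS (0 : Matrix n n ℂ) = 0 := rfl

/-- A real scalar passes through the adjoint. [folklore] -/
theorem conjTranspose_real_smul (r : ℝ) (X : Matrix n n ℂ) : (r • X)ᴴ = r • Xᴴ := by
  rw [Matrix.conjTranspose_smul, star_trivial]

variable [Fintype n]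

/-- (17): `⟨X, Y⟩ := Re tr X⋆Y = Re Tr (X⋆Y) / N`. [cite: Balaban1985Averaging, (17) p.20] -/
instance : Inner ℝ (HS n) := ⟨fun v w => ((mat v)ᴴ * mat w).trace.re / Fintype.card n⟩

/-- Unfolding (17): `⟨v, w⟩ = Re Tr (v⋆ w) / N`. [cite: Balaban1985Averaging, (17) p.20] -/
theorem inner_def (v w : HS n) : ⟪v, w⟫_ℝ = ((mat v)ᴴ * mat w).trace.re / Fintype.card n := rfl

/-- `⟨X, X⟩ = (1/N) Σ_{ij} |X_ij|² = MatrixNorms.nhsNormSq X`. [cite: Balaban1985Averaging, (17) p.20] -/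
theorem inner_self_eq (v : HS n) : ⟪v, v⟫_ℝ = nhsNormSq (mat v) := by
  rw [inner_def, nhsNormSq, sum_norm_sq_eq_re_trace]

/-- `(M_N(ℂ), Re tr X⋆Y)` is a real inner-product space (B7 p. 20: "a scalar product"); the norm is the `L²` norm
`(tr X⋆X)^{1/2}` of p. 21. [cite: Balaban1985Averaging, (17) p.20] -/
instance instNormedAddCommGroup : NormedAddCommGroup (HS n) :=
  @InnerProductSpace.Core.toNormedAddCommGroup ℝ (HS n) _ _ _
    { toInner := inferInstance
      conj_inner_symm := fun v w => by
        rw [starRingEnd_apply, star_trivial]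
        show ((mat w)ᴴ * mat v).trace.re / _ = ((mat v)ᴴ * mat w).trace.re / _
        have h : (mat w)ᴴ * mat v = ((mat v)ᴴ * mat w)ᴴ := by
          rw [Matrix.conjTranspose_mul, Matrix.conjTranspose_conjTranspose]
        rw [h, Matrix.trace_conjTranspose, Complex.star_def, Complex.conj_re]
      re_inner_nonneg := fun v => by
        rw [RCLike.re_to_real]
        show 0 ≤ ((mat v)ᴴ * mat v).trace.re / _
        rw [← sum_norm_sq_eq_re_trace]
        positivity
      add_left := fun u v w => by
        show ((mat u + mat v)ᴴ * mat w).trace.re / _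
          = ((mat u)ᴴ * mat w).trace.re / _ + ((mat v)ᴴ * mat w).trace.re / _
        rw [Matrix.conjTranspose_add, Matrix.add_mul, Matrix.trace_add, Complex.add_re, add_div]
      smul_left := fun u w r => by
        rw [starRingEnd_apply, star_trivial]
        show ((r • mat u)ᴴ * mat w).trace.re / _ = r * (((mat u)ᴴ * mat w).trace.re / _)
        rw [conjTranspose_real_smul, Matrix.smul_mul, Matrix.trace_smul, Complex.smul_re, smul_eq_mul,
          mul_div_assoc]
      definite := fun v hv => by
        have h : nhsNormSq (mat v) = 0 := by rw [← inner_self_eq]; exact hv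
        apply mat_injective
        rw [mat_zero]
        rcases isEmpty_or_nonempty n with hn | hn
        · exact Subsingleton.elim _ _
        · have hN : (Fintype.card n : ℝ) ≠ 0 := Nat.cast_ne_zero.mpr Fintype.card_ne_zero
          rw [nhsNormSq, div_eq_zero_iff, or_iff_left hN] at h
          ext i j
          have hi := (Finset.sum_eq_zero_iff_of_nonneg fun i _ =>
            Finset.sum_nonneg fun j _ => sq_nonneg (‖mat v i j‖)).1 h i (Finset.mem_univ _)
          have hij := (Finset.sum_eq_zero_iff_of_nonneg fun j _ => sq_nonneg (‖mat v i j‖)).1 hi j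
            (Finset.mem_univ _)
          simpa using hij }

/-- `HS n` is a real inner-product space for the scalar product (17). [cite: Balaban1985Averaging, (17) p.20] -/
instance instInnerProductSpace : InnerProductSpace ℝ (HS n) := InnerProductSpace.ofCore _

/-- `‖X‖² = ⟨X, X⟩ = nhsNormSq X`. [cite: Balaban1985Averaging, (17) p.20] -/
theorem norm_sq_eq (v : HS n) : ‖v‖ ^ 2 = nhsNormSq (mat v) := by
  rw [← real_inner_self_eq_norm_sq, inner_self_eq]

/-- The norm of `HS n` is the `L²` norm `MatrixNorms.nhsNorm` of p. 21. [cite: Balaban1985Averaging, (17) p.20] -/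
theorem norm_eq (v : HS n) : ‖v‖ = nhsNorm (mat v) := by
  rw [nhsNorm, ← norm_sq_eq, Real.sqrt_sq (norm_nonneg _)]

/-- `‖toHS X‖ = MatrixNorms.nhsNorm X` (the `L²` norm of p. 21). [cite: Balaban1985Averaging, (17) p.20] -/
theorem norm_toHS (X : Matrix n n ℂ) : ‖toHS X‖ = nhsNorm X := norm_eq _

/-- The `L²` norm is invariant under the adjoint. [folklore] -/
theorem norm_toHS_conjTranspose (X : Matrix n n ℂ) : ‖toHS Xᴴ‖ = ‖toHS X‖ := by
  rw [norm_toHS, norm_toHS, nhsNorm, nhsNorm, nhsNormSq_conjTranspose]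

variable [DecidableEq n]

/-- **(20) p. 21: `‖X‖ ≤ |X|`** — the `L²` norm of (17) is dominated by the operator norm (19)
(`MatrixNorms.nhsNorm_le_opNorm`). [cite: Balaban1985Averaging, (20) p.21] -/
theorem norm_toHS_le (X : Matrix n n ℂ) : ‖toHS X‖ ≤ ‖X‖ := by
  rw [norm_toHS]
  exact nhsNorm_le_opNorm X

/-- Cyclicity: `Tr (U M U⋆) = Tr M` for `U⋆U = 1`. [folklore] -/
theorem trace_unitary_conj {U : Matrix n n ℂ} (hU : star U * U = 1) (M : Matrix n n ℂ) :
    (U * M * star U).trace = M.trace := by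
  rw [Matrix.mul_assoc, Matrix.trace_mul_comm, Matrix.mul_assoc, hU, Matrix.mul_one]

/-- The `L²` norm (17) is invariant under unitary conjugation `X ↦ U X U⋆`. [folklore] -/
theorem nhsNormSq_unitary_conj {U : Matrix n n ℂ} (hU : star U * U = 1) (X : Matrix n n ℂ) :
    nhsNormSq (U * X * star U) = nhsNormSq X := by
  rw [nhsNormSq, nhsNormSq, sum_norm_sq_eq_re_trace, sum_norm_sq_eq_re_trace]
  have h1 : (U * X * star U)ᴴ * (U * X * star U) = U * (Xᴴ * (star U * U) * X) * star U := by
    rw [Matrix.star_eq_conjTranspose]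
    simp only [Matrix.conjTranspose_mul, Matrix.conjTranspose_conjTranspose, Matrix.mul_assoc]
  rw [h1, hU, Matrix.mul_one, trace_unitary_conj hU]

/-- Unitary conjugation `X ↦ U X U⋆` is an isometry of the `L²` norm (17). [folklore] -/
theorem norm_toHS_unitary_conj {U : Matrix n n ℂ} (hU : star U * U = 1) (X : Matrix n n ℂ) :
    ‖toHS (U * X * star U)‖ = ‖toHS X‖ := by
  rw [norm_toHS, norm_toHS, nhsNorm, nhsNorm, nhsNormSq_unitary_conj hU]

end HilbertSchmidt

/-! ## §2 The Lie algebra `u(N)` (skew-hermitian matrices) as a subspace of `HS n`, and the real-linear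
skew-hermitian part `π : M_N(ℂ) → u(N)` -/

section SkewPart

variable {n : Type*}

/-- The skew-hermitian part `½(X − X⋆)` of a matrix. [folklore] -/
def skewPartM (X : Matrix n n ℂ) : Matrix n n ℂ := (2⁻¹ : ℝ) • (X - Xᴴ)

/-- The skew part is skew-hermitian. [folklore] -/
theorem skewPartM_conjTranspose (X : Matrix n n ℂ) : (skewPartM X)ᴴ = -skewPartM X := by
  rw [skewPartM, conjTranspose_real_smul, Matrix.conjTranspose_sub, Matrix.conjTranspose_conjTranspose,
    ← smul_neg, neg_sub]

/-- On skew-hermitian matrices the skew part is the identity. [folklore] -/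
theorem skewPartM_of_skew {X : Matrix n n ℂ} (hX : Xᴴ = -X) : skewPartM X = X := by
  rw [skewPartM, hX, sub_neg_eq_add, ← two_smul ℝ X, smul_smul]
  norm_num

/-- The skew part is additive. [folklore] -/
theorem skewPartM_add (X Y : Matrix n n ℂ) : skewPartM (X + Y) = skewPartM X + skewPartM Y := by
  rw [skewPartM, skewPartM, skewPartM, Matrix.conjTranspose_add, ← smul_add]
  congr 1
  abel

/-- The skew part is real-homogeneous. [folklore] -/
theorem skewPartM_smul (r : ℝ) (X : Matrix n n ℂ) : skewPartM (r • X) = r • skewPartM X := by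
  rw [skewPartM, skewPartM, conjTranspose_real_smul, ← smul_sub, smul_comm]

/-- **`u(N)`, the Lie algebra of `U(N)`** (B7 p. 18: `G` a Lie subgroup of `U(N)` with algebra `g ⊂ u(N)`; (22)–(23)
p. 21: `log U = iA`, `A` hermitian): the skew-hermitian matrices as a real subspace of `HS n`, hence a real
inner-product space for the scalar product (17). [cite: Balaban1985Averaging, p.18, (17) p.20, (22)–(23) p.21] -/
def uN (n : Type*) : Submodule ℝ (HS n) where
  carrier := {v | (mat v)ᴴ = -mat v}
  add_mem' {v w} hv hw := by
    have hv' : (mat v)ᴴ = -mat v := hv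
    have hw' : (mat w)ᴴ = -mat w := hw
    show (mat v + mat w)ᴴ = -(mat v + mat w)
    rw [Matrix.conjTranspose_add, hv', hw', neg_add]
  zero_mem' := by
    show (mat (0 : HS n))ᴴ = -mat (0 : HS n)
    rw [mat_zero, Matrix.conjTranspose_zero, neg_zero]
  smul_mem' r v hv := by
    have hv' : (mat v)ᴴ = -mat v := hv
    show (r • mat v)ᴴ = -(r • mat v)
    rw [conjTranspose_real_smul, hv', smul_neg]

/-- Membership in `u(N)`: the underlying matrix is skew-hermitian. [folklore] -/
theorem mem_uN {v : HS n} : v ∈ uN n ↔ (mat v)ᴴ = -mat v := Iff.rfl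

/-- The skew part of the underlying matrix of an element of `u(N)`. [folklore] -/
theorem mat_skew (v : uN n) : (mat (v : HS n))ᴴ = -mat (v : HS n) := v.2

/-- **The real-linear map `π : M_N(ℂ) → u(N)`, `X ↦ ½(X − X⋆)` read in `HS n`** — the identification (id-V) of the
lineage records: it is the identity on `u(N)` (where all the logarithms (21) of the estimates live, (22)–(23)), it is
`1`-Lipschitz from the operator norm (19) to the `L²` norm (17) ((20)), and it commutes with unitary conjugation.
[cite: Balaban1985Averaging, (17) p.20, (20) p.21, (22)–(23) p.21] -/
def piU : Matrix n n ℂ →ₗ[ℝ] uN n where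
  toFun X := ⟨toHS (skewPartM X), (skewPartM_conjTranspose X : (mat (toHS (skewPartM X)))ᴴ = -mat (toHS _))⟩
  map_add' X Y := by
    apply Subtype.ext
    show toHS (skewPartM (X + Y)) = toHS (skewPartM X) + toHS (skewPartM Y)
    rw [skewPartM_add]
    rfl
  map_smul' r X := by
    apply Subtype.ext
    show toHS (skewPartM (r • X)) = r • toHS (skewPartM X)
    rw [skewPartM_smul]
    rfl

/-- `π X`, read in `HS n`, is the skew part of `X`. [folklore] -/
@[simp] theorem coe_piU (X : Matrix n n ℂ) : ((piU X : uN n) : HS n) = toHS (skewPartM X) := rfl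

/-- The underlying matrix of `π X` is the skew part of `X`. [folklore] -/
theorem mat_piU (X : Matrix n n ℂ) : mat ((piU X : uN n) : HS n) = skewPartM X := rfl

/-- `π` is the identity on skew-hermitian matrices. [folklore] -/
theorem coe_piU_of_skew {X : Matrix n n ℂ} (hX : Xᴴ = -X) : ((piU X : uN n) : HS n) = toHS X := by
  rw [coe_piU, skewPartM_of_skew hX]

variable [Fintype n]

/-- The skew part commutes with conjugation `X ↦ U X U⋆`. [folklore] -/
theorem skewPartM_conj (U X : Matrix n n ℂ) : skewPartM (U * X * star U) = U * skewPartM X * star U := by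
  rw [Matrix.star_eq_conjTranspose]
  simp only [skewPartM, Matrix.conjTranspose_mul, Matrix.conjTranspose_conjTranspose, Matrix.mul_smul,
    Matrix.smul_mul, Matrix.mul_sub, Matrix.sub_mul, Matrix.mul_assoc]

/-- `‖π X‖ ≤ ‖X‖_{L²}`. [folklore] -/
theorem norm_piU_le_norm_toHS (X : Matrix n n ℂ) : ‖piU X‖ ≤ ‖toHS X‖ := by
  rw [Submodule.coe_norm, coe_piU, skewPartM, toHS_smul, toHS_sub, norm_smul,
    show ‖(2⁻¹ : ℝ)‖ = 2⁻¹ by norm_num]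
  calc 2⁻¹ * ‖toHS X - toHS Xᴴ‖ ≤ 2⁻¹ * (‖toHS X‖ + ‖toHS Xᴴ‖) := by
        gcongr
        exact norm_sub_le _ _
    _ = ‖toHS X‖ := by rw [norm_toHS_conjTranspose]; ring

/-- On skew-hermitian `X`, `‖π X‖ = ‖X‖_{L²} = nhsNorm X`. [folklore] -/
theorem norm_piU_of_skew {X : Matrix n n ℂ} (hX : Xᴴ = -X) : ‖piU X‖ = nhsNorm X := by
  rw [Submodule.coe_norm, coe_piU_of_skew hX, norm_toHS]

variable [DecidableEq n]

/-- `‖π (U X U⋆)‖ = ‖π X‖` for `U⋆U = 1`. [folklore] -/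
theorem norm_piU_conj {U : Matrix n n ℂ} (hU : star U * U = 1) (X : Matrix n n ℂ) :
    ‖piU (U * X * star U)‖ = ‖piU X‖ := by
  rw [Submodule.coe_norm, Submodule.coe_norm, coe_piU, coe_piU, skewPartM_conj, norm_toHS_unitary_conj hU]

/-- **(20) through `π`: `‖π X‖ ≤ |X|`** (operator norm (19) on the right). [cite: Balaban1985Averaging, (20) p.21] -/
theorem norm_piU_le (X : Matrix n n ℂ) : ‖piU X‖ ≤ ‖X‖ := (norm_piU_le_norm_toHS X).trans (norm_toHS_le X)

/-- `‖π A − π B‖ ≤ |A − B|`. [folklore] -/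
theorem norm_piU_sub_le (A B : Matrix n n ℂ) : ‖piU A - piU B‖ ≤ ‖A - B‖ := by
  rw [← map_sub]
  exact norm_piU_le _

/-- **(id-V) for weighted sums:** `‖π A − Σ_x w_x • π M_x‖ ≤ |A − Σ_x w_x • M_x|` — an operator-norm estimate of a
real combination in `M_N(ℂ)` PUSHES FORWARD along the real-linear `1`-Lipschitz `π` to the inner-product space
`u(N)`. [cite: Balaban1985Averaging, (20) p.21] -/
theorem norm_piU_sub_sum_le {X : Type*} (s : Finset X) (w : X → ℝ) (A : Matrix n n ℂ) (M : X → Matrix n n ℂ) :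
    ‖piU A - ∑ x ∈ s, w x • piU (M x)‖ ≤ ‖A - ∑ x ∈ s, w x • M x‖ := by
  have h : piU A - ∑ x ∈ s, w x • piU (M x) = piU (n := n) (A - ∑ x ∈ s, w x • M x) := by
    simp only [map_sub, map_sum, map_smul]
  rw [h]
  exact norm_piU_le _

end SkewPart

/-! ## §3 The Wilson weight on `u(N)`: `e(X) = 1 − Re tr e^X` and its sandwich
`‖X‖²/2 − (N/24)‖X‖⁴ ≤ e(X) ≤ ‖X‖²/2` (spectral calculus) -/

section Weight

variable {n : Type*} [Fintype n] [DecidableEq n]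

/-- **The single-plaquette Wilson weight as a function on `u(N)`:** `e(X) := 1 − Re tr e^X` (`tr = Tr/N`, B12 (0.2)),
so that `1 − Re tr U = e(log U)` for a unitary `U` near `1` ((22)–(23)). [cite: Balaban1987RG1, (0.2) p.252]
[cite: Balaban1985Averaging, (22)–(23) p.21] -/
def eN (v : uN n) : ℝ := 1 - nReTr (exp (mat (v : HS n)))

/-- Spectral frame of a skew-hermitian matrix: `Z = U · diag(−iθ) · U⋆`, `U` unitary, `θ` real (the spectral
theorem for the hermitian matrix `iZ`, Mathlib `Matrix.IsHermitian.spectral_theorem`). [folklore] -/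
theorem skew_frame {Z : Matrix n n ℂ} (hZ : Zᴴ = -Z) :
    ∃ (U : Matrix n n ℂ) (θ : n → ℝ), star U * U = 1 ∧ U * star U = 1 ∧
      Z = U * Matrix.diagonal (fun a => -I * (θ a : ℂ)) * star U := by
  have hA : (I • Z).IsHermitian := by
    show (I • Z)ᴴ = I • Z
    rw [Matrix.conjTranspose_smul, hZ, Complex.star_def, Complex.conj_I, smul_neg, neg_smul, neg_neg]
  refine ⟨(hA.eigenvectorUnitary : Matrix n n ℂ), hA.eigenvalues, Unitary.coe_star_mul_self hA.eigenvectorUnitary,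
    Unitary.coe_mul_star_self hA.eigenvectorUnitary, ?_⟩
  have h := hA.spectral_theorem
  rw [Unitary.conjStarAlgAut_apply] at h
  have e : Matrix.diagonal (fun a => -I * (hA.eigenvalues a : ℂ))
      = (-I) • Matrix.diagonal (RCLike.ofReal ∘ hA.eigenvalues : n → ℂ) := by
    rw [← Matrix.diagonal_smul]
    congr 1
  rw [e, Matrix.mul_smul, Matrix.smul_mul, ← h, smul_smul]
  simp

/-- `exp (U D U⋆) = U exp(D) U⋆` with `exp diag = diag exp` (Mathlib `Matrix.exp_units_conj`, `Matrix.exp_diagonal`).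
[folklore] -/
theorem exp_frame {U : Matrix n n ℂ} (hU : star U * U = 1) (hU' : U * star U = 1) (D : n → ℂ) :
    exp (U * Matrix.diagonal D * star U) = U * Matrix.diagonal (fun a => Complex.exp (D a)) * star U := by
  let Uu : (Matrix n n ℂ)ˣ := ⟨U, star U, hU', hU⟩
  have h := Matrix.exp_units_conj Uu (Matrix.diagonal D)
  have h1 : (Uu : Matrix n n ℂ) = U := rfl
  have h2 : ((Uu⁻¹ : (Matrix n n ℂ)ˣ) : Matrix n n ℂ) = star U := rfl
  rw [h1, h2] at h
  rw [h, Matrix.exp_diagonal]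
  congr 2
  funext a
  rw [Pi.exp_def, ← Complex.exp_eq_exp_ℂ]

/-- Spectral data of a skew-hermitian matrix: `Re Tr e^Z = Σ_a cos θ_a` and `Σ_{ab} |Z_ab|² = Σ_a θ_a²`. [folklore] -/
theorem skew_spectral {Z : Matrix n n ℂ} (hZ : Zᴴ = -Z) :
    ∃ θ : n → ℝ, (Matrix.trace (exp Z)).re = ∑ a, Real.cos (θ a) ∧
      ∑ a, ∑ b, ‖Z a b‖ ^ 2 = ∑ a, θ a ^ 2 := by
  obtain ⟨U, θ, hU, hU', hZU⟩ := skew_frame hZ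
  refine ⟨θ, ?_, ?_⟩
  · rw [hZU, exp_frame hU hU', trace_unitary_conj hU, Matrix.trace_diagonal, Complex.re_sum]
    refine Finset.sum_congr rfl fun a _ => ?_
    rw [Complex.exp_re]
    simp
  · rw [sum_norm_sq_eq_re_trace, hZ, neg_mul]
    have hZZ : Z * Z = U * Matrix.diagonal (fun a => -I * (θ a : ℂ) * (-I * (θ a : ℂ))) * star U := by
      conv_lhs => rw [hZU]
      rw [show U * Matrix.diagonal (fun a => -I * (θ a : ℂ)) * star U
            * (U * Matrix.diagonal (fun a => -I * (θ a : ℂ)) * star U)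
          = U * (Matrix.diagonal (fun a => -I * (θ a : ℂ))
            * ((star U * U) * Matrix.diagonal (fun a => -I * (θ a : ℂ)))) * star U by noncomm_ring,
        hU, Matrix.one_mul, Matrix.diagonal_mul_diagonal]
    rw [hZZ, Matrix.trace_neg, trace_unitary_conj hU, Matrix.trace_diagonal, Complex.neg_re, Complex.re_sum,
      ← Finset.sum_neg_distrib]
    refine Finset.sum_congr rfl fun a _ => ?_
    have : -I * (θ a : ℂ) * (-I * (θ a : ℂ)) = -((θ a : ℂ) ^ 2) := by
      rw [show -I * (θ a : ℂ) * (-I * (θ a : ℂ)) = (I * I) * (θ a : ℂ) ^ 2 by ring, Complex.I_mul_I]; ring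
    rw [this, Complex.neg_re, neg_neg, ← Complex.ofReal_pow, Complex.ofReal_re]

omit [DecidableEq n] in
/-- `Σ_a θ_a⁴ ≤ (Σ_a θ_a²)²`. [folklore] -/
theorem sum_pow_four_le (θ : n → ℝ) : ∑ a, θ a ^ 4 ≤ (∑ a, θ a ^ 2) ^ 2 := by
  have hle : ∀ a, θ a ^ 2 ≤ ∑ b, θ b ^ 2 := fun a =>
    Finset.single_le_sum (f := fun b => θ b ^ 2) (fun b _ => sq_nonneg (θ b)) (Finset.mem_univ a)
  calc ∑ a, θ a ^ 4 = ∑ a, θ a ^ 2 * θ a ^ 2 := Finset.sum_congr rfl fun a _ => by ring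
    _ ≤ ∑ a, θ a ^ 2 * ∑ b, θ b ^ 2 :=
        Finset.sum_le_sum fun a _ => mul_le_mul_of_nonneg_left (hle a) (sq_nonneg _)
    _ = (∑ a, θ a ^ 2) ^ 2 := by rw [← Finset.sum_mul]; ring

/-- **The weight sandwich on skew-hermitian matrices, in terms of the `L²` norm (17):** for `Z⋆ = −Z` with
eigenvalues `−iθ_a`, `1 − Re tr e^Z = (1/N) Σ_a (1 − cos θ_a)` and `‖Z‖² = (1/N) Σ_a θ_a²`, so the scalar sandwich
`x²/2 − x⁴/24 ≤ 1 − cos x ≤ x²/2` (`T4TermwiseQuartic.one_sub_cos_sandwich`) and `Σ θ⁴ ≤ (Σ θ²)² = N²‖Z‖⁴` give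
`‖Z‖²/2 − (N/24)‖Z‖⁴ ≤ 1 − Re tr e^Z ≤ ‖Z‖²/2` and `0 ≤ 1 − Re tr e^Z`. The constant `N/24` is sharp for `N = 1`
and is the price of measuring a single large eigenvalue in the NORMALISED trace norm. [folklore] -/
theorem weight_sandwich [Nonempty n] {Z : Matrix n n ℂ} (hZ : Zᴴ = -Z) :
    nhsNormSq Z / 2 - (Fintype.card n : ℝ) / 24 * nhsNormSq Z ^ 2 ≤ 1 - nReTr (exp Z) ∧
      1 - nReTr (exp Z) ≤ nhsNormSq Z / 2 ∧ 0 ≤ 1 - nReTr (exp Z) := by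
  obtain ⟨θ, hcos, hsq⟩ := skew_spectral hZ
  have hN : (0 : ℝ) < Fintype.card n := Nat.cast_pos.mpr Fintype.card_pos
  have hns : nhsNormSq Z = (∑ a, θ a ^ 2) / Fintype.card n := by rw [nhsNormSq, hsq]
  have hw : 1 - nReTr (exp Z) = (∑ a, (1 - Real.cos (θ a))) / Fintype.card n := by
    rw [nReTr, hcos, Finset.sum_sub_distrib, Finset.sum_const, Finset.card_univ, nsmul_eq_mul, mul_one]
    field_simp
  have hup : ∑ a, (1 - Real.cos (θ a)) ≤ ∑ a, θ a ^ 2 / 2 :=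
    Finset.sum_le_sum fun a _ => (T4TermwiseQuartic.one_sub_cos_sandwich (θ a)).2
  have hlo : ∑ a, (θ a ^ 2 / 2 - 1 / 24 * θ a ^ 4) ≤ ∑ a, (1 - Real.cos (θ a)) :=
    Finset.sum_le_sum fun a _ => (T4TermwiseQuartic.one_sub_cos_sandwich (θ a)).1
  have h0 : 0 ≤ ∑ a, (1 - Real.cos (θ a)) := Finset.sum_nonneg fun a _ => by linarith [Real.cos_le_one (θ a)]
  have h4 := sum_pow_four_le θ
  rw [hw, hns]
  refine ⟨?_, ?_, div_nonneg h0 hN.le⟩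
  · rw [Finset.sum_sub_distrib, ← Finset.sum_div, ← Finset.mul_sum] at hlo
    have key : (∑ a, θ a ^ 2) / ↑(Fintype.card n) / 2
          - ↑(Fintype.card n) / 24 * ((∑ a, θ a ^ 2) / ↑(Fintype.card n)) ^ 2
        = ((∑ a, θ a ^ 2) / 2 - 1 / 24 * (∑ a, θ a ^ 2) ^ 2) / Fintype.card n := by
      field_simp
    rw [key]
    refine div_le_div_of_nonneg_right ?_ hN.le
    linarith
  · rw [← Finset.sum_div] at hup
    have key : (∑ a, θ a ^ 2) / ↑(Fintype.card n) / 2 = ((∑ a, θ a ^ 2) / 2) / Fintype.card n := by ring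
    rw [key]
    exact div_le_div_of_nonneg_right hup hN.le

/-- **The binder `he` of generation 10's `T4TermwiseQuartic.interpolation_averaging_of_regular` for `V = u(N)`,
`e = eN`, `q₄ = N/24`:** `‖v‖²/2 − (N/24)‖v‖⁴ ≤ e(v) ≤ ‖v‖²/2` for EVERY `v ∈ u(N)` (no smallness), in the `L²`
norm (17). [folklore] -/
theorem eN_sandwich [Nonempty n] (v : uN n) :
    ‖v‖ ^ 2 / 2 - (Fintype.card n : ℝ) / 24 * ‖v‖ ^ 4 ≤ eN v ∧ eN v ≤ ‖v‖ ^ 2 / 2 := by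
  have h2 : ‖v‖ ^ 2 = nhsNormSq (mat (v : HS n)) := by rw [Submodule.coe_norm, norm_sq_eq]
  have h4 : ‖v‖ ^ 4 = nhsNormSq (mat (v : HS n)) ^ 2 := by rw [← h2]; ring
  rw [h2, h4]
  have h := weight_sandwich (mat_skew v)
  exact ⟨h.1, h.2.1⟩

/-- `0 ≤ e(v)`. [folklore] -/
theorem eN_nonneg [Nonempty n] (v : uN n) : 0 ≤ eN v := (weight_sandwich (mat_skew v)).2.2

end Weight

/-! ## §4 `U(N)`-valued configurations under (44): unitarity of transports and of the average (42), skewness of the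
logarithms, closeness to `1` -/

section Config

variable {n : Type*} [Fintype n] [DecidableEq n] {d : ℕ}

/-- `U(N)`-valued bond variables are norm-bounded units (19) (`B7Prop2Explicit.unitaryUnits_le_U1`).
[cite: Balaban1985Averaging, (19) p.21] -/
theorem U1_of_U [Nonempty n] {V : B7Prop1Explicit.Site d → Fin d → (Matrix n n ℂ)ˣ} (hV : ∀ x κ, V x κ ∈ unitaryUnits (Matrix n n ℂ))
    (x : B7Prop1Explicit.Site d) (κ : Fin d) : V x κ ∈ U1 (Matrix n n ℂ) := by
  letI : CStarAlgebra (Matrix n n ℂ) := {}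
  exact unitaryUnits_le_U1 (hV x κ)

/-- Parallel transports (9) of a `U(N)`-valued configuration are unitary. [folklore] -/
theorem hol_mem_U {V : B7Prop1Explicit.Site d → Fin d → (Matrix n n ℂ)ˣ} (hV : ∀ x κ, V x κ ∈ unitaryUnits (Matrix n n ℂ))
    (x : B7Prop1Explicit.Site d) (w : List (Letter d)) : hol V x w ∈ unitaryUnits (Matrix n n ℂ) :=
  hol_mem_of hV x w

/-- The axial gauge function (p. 24) of a `U(N)`-valued configuration is unitary. [folklore] -/
theorem axialFn_mem_U {V : B7Prop1Explicit.Site d → Fin d → (Matrix n n ℂ)ˣ} (hV : ∀ x κ, V x κ ∈ unitaryUnits (Matrix n n ℂ))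
    (y x : B7Prop1Explicit.Site d) : axialFn V y x ∈ unitaryUnits (Matrix n n ℂ) :=
  hol_mem_of hV _ _

/-- The `L`-plaquette variable of a `U(N)`-valued `L`-lattice configuration is unitary. [folklore] -/
theorem cplaq_mem_U (L : ℕ) {W : B7Prop1Explicit.Site d → Fin d → (Matrix n n ℂ)ˣ} (hW : ∀ x κ, W x κ ∈ unitaryUnits (Matrix n n ℂ))
    (z : B7Prop1Explicit.Site d) (μ ν : Fin d) : cplaq L W z μ ν ∈ unitaryUnits (Matrix n n ℂ) := by
  unfold cplaq
  exact Subgroup.mul_mem _ (Subgroup.mul_mem _ (Subgroup.mul_mem _ (hW _ _) (hW _ _))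
    (Subgroup.inv_mem _ (hW _ _))) (Subgroup.inv_mem _ (hW _ _))

/-- For a unitary unit, `W⁻¹ = W⋆`. [folklore] -/
theorem val_inv_eq_star {W : (Matrix n n ℂ)ˣ} (hW : W ∈ unitaryUnits (Matrix n n ℂ)) : ((W⁻¹ : (Matrix n n ℂ)ˣ) : Matrix n n ℂ) = star (W : Matrix n n ℂ) :=
  Units.inv_eq_of_mul_eq_one_left (Unitary.star_mul_self_of_mem hW)

/-- `‖π (W X W⁻¹)‖ = ‖π X‖` for a unitary unit `W` (isometric conjugation in the `L²` norm (17)). [folklore] -/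
theorem norm_piU_units_conj {W : (Matrix n n ℂ)ˣ} (hW : W ∈ unitaryUnits (Matrix n n ℂ)) (X : Matrix n n ℂ) :
    ‖piU ((W : Matrix n n ℂ) * X * ((W⁻¹ : (Matrix n n ℂ)ˣ) : Matrix n n ℂ))‖ = ‖piU X‖ := by
  rw [val_inv_eq_star hW]
  exact norm_piU_conj (Unitary.star_mul_self_of_mem hW) X

/-- **(22)–(23) p. 21:** the logarithm (21) of a unitary within `1/4` of `1` is skew-hermitian
(`B7Prop2Explicit.star_mlog_eq_neg`). [cite: Balaban1985Averaging, (22)–(23) p.21] -/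
theorem mlog_skew {U : (Matrix n n ℂ)ˣ} (hU : U ∈ unitaryUnits (Matrix n n ℂ)) (h : ‖(U : Matrix n n ℂ) - 1‖ ≤ 1 / 4) :
    (MatrixLog.mlog (U : Matrix n n ℂ))ᴴ = -MatrixLog.mlog (U : Matrix n n ℂ) := by
  letI : CStarAlgebra (Matrix n n ℂ) := {}
  exact star_mlog_eq_neg (mem_unitaryUnits.1 hU) h

/-- The smallness bookkeeping of this leaf: `512(d+1)(d+4)L²α₀ ≤ 1`, `L ≥ 1`, `α₀ ≥ 0` ⟹
`θ := 8(d+1)(d+4)L²α₀ ≤ 1/64`, `α₀ ≤ L²α₀ ≤ θ`. [folklore] -/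
theorem smallness_unfold {L : ℕ} (hL : 1 ≤ L) {α₀ : ℝ} (hα₀ : 0 ≤ α₀)
    (hsmall : 512 * (d + 1) * (d + 4) * (L : ℝ) ^ 2 * α₀ ≤ 1) :
    8 * (d + 1) * (d + 4) * (L : ℝ) ^ 2 * α₀ ≤ 1 / 64 ∧ α₀ ≤ (L : ℝ) ^ 2 * α₀ ∧
      (L : ℝ) ^ 2 * α₀ ≤ 8 * (d + 1) * (d + 4) * (L : ℝ) ^ 2 * α₀ := by
  have hL2 : (1 : ℝ) ≤ (L : ℝ) ^ 2 := one_le_pow₀ (by exact_mod_cast hL)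
  have hd : (0 : ℝ) ≤ d := Nat.cast_nonneg d
  have hA : (1 : ℝ) ≤ 8 * ((d : ℝ) + 1) * (d + 4) := by nlinarith
  have h2 : 0 ≤ (L : ℝ) ^ 2 * α₀ := by positivity
  refine ⟨?_, le_mul_of_one_le_left hα₀ hL2, ?_⟩
  · have h : 8 * (d + 1) * (d + 4) * (L : ℝ) ^ 2 * α₀ = (512 * (d + 1) * (d + 4) * (L : ℝ) ^ 2 * α₀) / 64 := by
      ring
    rw [h]
    linarith
  calc (L : ℝ) ^ 2 * α₀ = 1 * ((L : ℝ) ^ 2 * α₀) := by ring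
    _ ≤ 8 * ((d : ℝ) + 1) * (d + 4) * ((L : ℝ) ^ 2 * α₀) := mul_le_mul_of_nonneg_right hA h2
    _ = 8 * ((d : ℝ) + 1) * (d + 4) * (L : ℝ) ^ 2 * α₀ := by ring

/-- Under (44) with the Prop. 2 smallness every plaquette variable is within `1/64` of the identity. [folklore] -/
theorem norm_hol_sub_one_le {V : B7Prop1Explicit.Site d → Fin d → (Matrix n n ℂ)ˣ} {L : ℕ} (hL : 1 ≤ L) {α₀ : ℝ} (hα₀ : 0 ≤ α₀)
    (hsmall : 512 * (d + 1) * (d + 4) * (L : ℝ) ^ 2 * α₀ ≤ 1)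
    (h44 : ∀ (x : B7Prop1Explicit.Site d) (κ κ' : Fin d), κ ≠ κ' → ‖((hol V x (plaqWord κ κ') : (Matrix n n ℂ)ˣ) : Matrix n n ℂ) - 1‖ ≤ α₀)
    {μ ν : Fin d} (hμν : μ ≠ ν) (x : B7Prop1Explicit.Site d) :
    ‖((hol V x (plaqWord μ ν) : (Matrix n n ℂ)ˣ) : Matrix n n ℂ) - 1‖ ≤ 1 / 64 := by
  obtain ⟨hθ, hαL, hLθ⟩ := smallness_unfold hL hα₀ hsmall
  linarith [h44 x μ ν hμν]

/-- Under (44) with the Prop. 2 smallness the average (42) of a `U(N)`-valued configuration is `U(N)`-valued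
(`B7Prop2Explicit.bavg_mem_unitaryUnits` at radius `1/4`; the `log`-arguments are within `2θ ≤ 1/32` of `1` by
`B7Prop2Explicit.norm_Wcx_sub_one_le`). [cite: Balaban1985Averaging, (42) p.23, (22)–(23) p.21] -/
theorem bavg_mem_U [Nonempty n] {V : B7Prop1Explicit.Site d → Fin d → (Matrix n n ℂ)ˣ} (hV : ∀ x κ, V x κ ∈ unitaryUnits (Matrix n n ℂ))
    (L : ℕ) (hL : 1 ≤ L) {α₀ : ℝ} (hα₀ : 0 ≤ α₀) (hsmall : 512 * (d + 1) * (d + 4) * (L : ℝ) ^ 2 * α₀ ≤ 1)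
    (h44 : ∀ (x : B7Prop1Explicit.Site d) (κ κ' : Fin d), κ ≠ κ' → ‖((hol V x (plaqWord κ κ') : (Matrix n n ℂ)ˣ) : Matrix n n ℂ) - 1‖ ≤ α₀) :
    ∀ q κ, bavg L V q κ ∈ unitaryUnits (Matrix n n ℂ) := by
  intro q κ
  letI : CStarAlgebra (Matrix n n ℂ) := {}
  obtain ⟨hθ, -, -⟩ := smallness_unfold hL hα₀ hsmall
  exact bavg_mem_unitaryUnits hV L q κ fun r =>
    (norm_Wcx_sub_one_le L hL V (U1_of_U hV) hα₀ hsmall h44 q κ r).trans (by linarith)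

/-- Under (44) with the Prop. 2 smallness the `L`-plaquette variable `V̄(∂p′)` of the average (42) is within `1/8`
of the identity (Proposition 1 (51): `|V̄(∂p′) − 1| ≤ L²α₀ + 226θ² ≤ θ + 226θ²`, `θ ≤ 1/64`).
[cite: Balaban1985Averaging, Prop. 1 (51) p.26] -/
theorem norm_cplaq_bavg_sub_one_le [Nonempty n] {V : B7Prop1Explicit.Site d → Fin d → (Matrix n n ℂ)ˣ} (hV : ∀ x κ, V x κ ∈ unitaryUnits (Matrix n n ℂ))
    (L : ℕ) (hL : 1 ≤ L) {α₀ : ℝ} (hα₀ : 0 ≤ α₀) (hsmall : 512 * (d + 1) * (d + 4) * (L : ℝ) ^ 2 * α₀ ≤ 1)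
    (h44 : ∀ (x : B7Prop1Explicit.Site d) (κ κ' : Fin d), κ ≠ κ' → ‖((hol V x (plaqWord κ κ') : (Matrix n n ℂ)ˣ) : Matrix n n ℂ) - 1‖ ≤ α₀)
    (z : B7Prop1Explicit.Site d) {μ ν : Fin d} (hμν : μ ≠ ν) :
    ‖((cplaq L (bavg L V) z μ ν : (Matrix n n ℂ)ˣ) : Matrix n n ℂ) - 1‖ ≤ (L : ℝ) ^ 2 * α₀ + 226 * (8 * (d + 1) * (d + 4) * (L : ℝ) ^ 2 * α₀) ^ 2 ∧
      ‖((cplaq L (bavg L V) z μ ν : (Matrix n n ℂ)ˣ) : Matrix n n ℂ) - 1‖ ≤ 1 / 8 := by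
  obtain ⟨hθ, -, hLα⟩ := smallness_unfold hL hα₀ hsmall
  have h51 := prop1_explicit L hL z hμν V (U1_of_U hV) hα₀ hsmall h44
  have hsq : (8 * (d + 1) * (d + 4) * (L : ℝ) ^ 2 * α₀) ^ 2 ≤ (1 / 64) ^ 2 :=
    pow_le_pow_left₀ (by positivity) hθ 2
  exact ⟨h51, by linarith⟩

end Config

/-! ## §5 The term-wise binders (bch)/(tr)/(sz)/(repr) of NE7 with values in `V = u(N)` -/

section Binders

variable {n : Type*} [Fintype n] [DecidableEq n] {d : ℕ} (T L : ℕ) (μ ν : Fin d)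

omit [Fintype n] [DecidableEq n] in
/-- `π` passes through the torus extension `textend` (a pointwise case split). [folklore] -/
theorem piU_textend (z : B7Prop1Explicit.Site d) (G D : B7Prop1Explicit.Site d → Matrix n n ℂ) (x : B7Prop1Explicit.Site d) :
    piU (textend T L μ ν z G D x) = textend T L μ ν z (fun x' => piU (G x')) (fun x' => piU (D x')) x := by
  unfold textend
  split_ifs <;> rfl

/-- **(bch) in `u(N)` — the kernel-form binder `hρA`/`hρB` of `T4TermwiseQuartic.interpolation_averaging_of_regular`
for Bałaban's concrete average (42) of a `U(N)`-VALUED configuration, with values in the real inner-product space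
`V = u(N)` (scalar product (17)):** with `ψ(p′) := π (log V̄(∂p′))` and `Φ(p′, x) := π (Φ_A(p′, x))`,
`‖ψ(p′) − Σ_{x ∈ [0,T)^d} w(a, x) • Φ(p′, x)‖ ≤ 280 θ²`, `θ = 8(d+1)(d+4)L²α₀` — `T4TermwiseTorus.bch_torus` (an
operator-norm estimate) pushed forward along the `1`-Lipschitz real-linear `π` ((20), `norm_piU_sub_sum_le`).
Finite torus, (44) + Prop. 2 smallness explicit; not an estimate printed in [Balaban1985Averaging] (its (bch) input is
the tree's kernel theorem `T4TermwiseBCH.bch_concrete`). [folklore] -/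
theorem bch_torus_piU [Nonempty n] (hL : 1 ≤ L) (h2L : 2 * L ≤ T) (a : B7Prop1Explicit.Site d) (hμν : μ ≠ ν)
    (V : B7Prop1Explicit.Site d → Fin d → (Matrix n n ℂ)ˣ) (hV : ∀ x κ, V x κ ∈ unitaryUnits (Matrix n n ℂ)) {α₀ : ℝ} (hα₀ : 0 ≤ α₀)
    (hsmall : 512 * (d + 1) * (d + 4) * (L : ℝ) ^ 2 * α₀ ≤ 1)
    (h44 : ∀ (x : B7Prop1Explicit.Site d) (κ κ' : Fin d), κ ≠ κ' → ‖((hol V x (plaqWord κ κ') : (Matrix n n ℂ)ˣ) : Matrix n n ℂ) - 1‖ ≤ α₀)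
    (u : B7Prop1Explicit.Site d → (Matrix n n ℂ)ˣ) (hu : u = axialFn V ((L : ℤ) • a + (L : ℤ) • e μ + (L : ℤ) • e ν))
    (φ : B7Prop1Explicit.Site d → Matrix n n ℂ) (hφ : φ = fun x => MatrixLog.mlog ((hol V x (plaqWord μ ν) : (Matrix n n ℂ)ˣ) : Matrix n n ℂ))
    (G : B7Prop1Explicit.Site d → Matrix n n ℂ) (hG : G = fun x' => ((((u ((L : ℤ) • a))⁻¹ * u x' : (Matrix n n ℂ)ˣ)) : Matrix n n ℂ) * φ x'
        * ((((u ((L : ℤ) • a))⁻¹ * u x')⁻¹ : (Matrix n n ℂ)ˣ) : Matrix n n ℂ)) :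
    ‖piU (MatrixLog.mlog ((cplaq L (bavg L V) ((L : ℤ) • a) μ ν : (Matrix n n ℂ)ˣ) : Matrix n n ℂ))
        - ∑ x ∈ box T, tker T L μ ν a x • piU (textend T L μ ν ((L : ℤ) • a) G φ x)‖
      ≤ 280 * (8 * (d + 1) * (d + 4) * (L : ℝ) ^ 2 * α₀) ^ 2 :=
  (norm_piU_sub_sum_le _ _ _ _).trans
    (bch_torus T L μ ν hL h2L a hμν V (U1_of_U hV) hα₀ hsmall h44 u hu φ hφ G hG)

/-- **(tr) in `u(N)` — the binder `hΦA`/`hΦB` AT EVERY `x`:** for a `T`-periodic `U(N)`-valued configuration,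
`‖π (Φ_A(p′, x))‖ = ‖π (log V(∂p_x))‖` — the transporters are unitary (conjugation is an `L²`-isometry commuting with
`π`) and `V(∂p)` depends only on the torus class of `p`. No smallness is needed. [folklore] -/
theorem norm_piU_textend_transport (z y : B7Prop1Explicit.Site d) {V : B7Prop1Explicit.Site d → Fin d → (Matrix n n ℂ)ˣ}
    (hV : ∀ x κ, V x κ ∈ unitaryUnits (Matrix n n ℂ)) (hper : IsPeriodic T V) (u : B7Prop1Explicit.Site d → (Matrix n n ℂ)ˣ)
    (hu : u = axialFn V y) (φ : B7Prop1Explicit.Site d → Matrix n n ℂ)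
    (hφ : φ = fun x => MatrixLog.mlog ((hol V x (plaqWord μ ν) : (Matrix n n ℂ)ˣ) : Matrix n n ℂ))
    (G : B7Prop1Explicit.Site d → Matrix n n ℂ)
    (hG : G = fun x' => ((((u z)⁻¹ * u x' : (Matrix n n ℂ)ˣ)) : Matrix n n ℂ) * φ x' * ((((u z)⁻¹ * u x')⁻¹ : (Matrix n n ℂ)ˣ) : Matrix n n ℂ))
    (x : B7Prop1Explicit.Site d) : ‖piU (textend T L μ ν z G φ x)‖ = ‖piU (φ x)‖ := by
  have huU : ∀ x', u x' ∈ unitaryUnits (Matrix n n ℂ) := fun x' => hu ▸ axialFn_mem_U hV _ x'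
  rw [piU_textend]
  refine norm_textend T L μ ν z (fun s _ x' hsx => ?_) x
  subst hG hφ
  simp only
  rw [norm_piU_units_conj ((unitaryUnits (Matrix n n ℂ)).mul_mem ((unitaryUnits (Matrix n n ℂ)).inv_mem (huU z)) (huU _)),
    (hper.hol (plaqWord μ ν)).eq_of_tcls_eq hsx]

/-- **(sz) in `u(N)`:** `‖π (log U)‖ ≤ |log U| ≤ 2|U − 1|` for `|U − 1| ≤ ½` ((20) and (26)).
[cite: Balaban1985Averaging, (20) p.21, (26) p.22] -/
theorem norm_piU_mlog_le {U : Matrix n n ℂ} (hU : ‖U - 1‖ ≤ 1 / 2) : ‖piU (MatrixLog.mlog U)‖ ≤ 2 * ‖U - 1‖ :=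
  (norm_piU_le _).trans (MatrixLog.norm_mlog_le_two_mul hU)

/-- **(repr) in `u(N)` — the single-plaquette Wilson weight through `π ∘ log`:** for a unitary `U` with
`|U − 1| ≤ 1/4`, `1 − Re tr U = e(π (log U))` (`log U` is skew-hermitian, (22)–(23), so `π (log U) = log U`, and
`e^{log U} = U`, `MatrixLog.exp_mlog`). [cite: Balaban1985Averaging, (22)–(23) p.21] [cite: Balaban1987RG1, (0.2) p.252] -/
theorem wilson_eq_eN {U : (Matrix n n ℂ)ˣ} (hU : U ∈ unitaryUnits (Matrix n n ℂ)) (h : ‖(U : Matrix n n ℂ) - 1‖ ≤ 1 / 4) :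
    1 - nReTr (U : Matrix n n ℂ) = eN (piU (MatrixLog.mlog (U : Matrix n n ℂ))) := by
  show 1 - nReTr (U : Matrix n n ℂ) = 1 - nReTr (exp (skewPartM (MatrixLog.mlog (U : Matrix n n ℂ))))
  rw [skewPartM_of_skew (mlog_skew hU h), MatrixLog.exp_mlog (by linarith)]

end Binders

/-! ## §6 Plane-labelled packaging: generation 10's `φA`, `ψA`, `ΦA` for `U(N)` as FUNCTIONS into `V = u(N)` over
the index type `(Fin d × Fin d) × ℤ^d` of `T4TermwiseTorus.pbox`, and their binders at one tower level -/

section Planes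

variable {n : Type*} [Fintype n] [DecidableEq n] {d : ℕ}

/-- The matrix-valued fine datum of a plane `P = (μ, ν)`: `x ↦ log V(∂p_x)`. [folklore] -/
def phiM (V : B7Prop1Explicit.Site d → Fin d → (Matrix n n ℂ)ˣ) (P : Fin d × Fin d) : B7Prop1Explicit.Site d → Matrix n n ℂ :=
  fun x => MatrixLog.mlog ((hol V x (plaqWord P.1 P.2) : (Matrix n n ℂ)ˣ) : Matrix n n ℂ)

/-- The matrix-valued TRANSPORTED fine datum attached to the coarse plaquette `y = (P, a)` (corner `L•a`):
`x' ↦ T(x') · log V(∂p_{x'}) · T(x')⁻¹`, `T(x') = u(L•a)⁻¹ u(x')`, `u` the axial gauge function based at the far corner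
`L•a + L•e_μ + L•e_ν` (the transport of `T4TermwiseBCH.bch_concrete` / `T4TermwiseTorus.bch_torus`). [folklore] -/
def GM (L : ℕ) (V : B7Prop1Explicit.Site d → Fin d → (Matrix n n ℂ)ˣ) (y : (Fin d × Fin d) × B7Prop1Explicit.Site d) :
    B7Prop1Explicit.Site d → Matrix n n ℂ :=
  fun x' =>
    ((((axialFn V ((L : ℤ) • y.2 + (L : ℤ) • e y.1.1 + (L : ℤ) • e y.1.2) ((L : ℤ) • y.2))⁻¹
          * axialFn V ((L : ℤ) • y.2 + (L : ℤ) • e y.1.1 + (L : ℤ) • e y.1.2) x' : (Matrix n n ℂ)ˣ)) : Matrix n n ℂ)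
      * phiM V y.1 x'
      * ((((axialFn V ((L : ℤ) • y.2 + (L : ℤ) • e y.1.1 + (L : ℤ) • e y.1.2) ((L : ℤ) • y.2))⁻¹
          * axialFn V ((L : ℤ) • y.2 + (L : ℤ) • e y.1.1 + (L : ℤ) • e y.1.2) x')⁻¹ : (Matrix n n ℂ)ˣ) : Matrix n n ℂ)

/-- **Generation 10's `φA K · x` for `U(N)`, valued in `V = u(N)`:** `φ_U(x) := π (log V(∂p_x))` for the plane-labelled
fine plaquette `x = ((μ, ν), site)`. [folklore] -/
def phiU (V : B7Prop1Explicit.Site d → Fin d → (Matrix n n ℂ)ˣ) (x : (Fin d × Fin d) × B7Prop1Explicit.Site d) : uN n :=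
  piU (phiM V x.1 x.2)

/-- **Generation 10's `ψA K · y` for `U(N)`, valued in `V = u(N)`:** `ψ_U(y) := π (log V̄(∂p′_y))`, `p′_y` the
`L`-plaquette of the averaged field (42) with corner `L•a` in the plane `(μ, ν)`, `y = ((μ, ν), a)`. [folklore] -/
def psiU (L : ℕ) (V : B7Prop1Explicit.Site d → Fin d → (Matrix n n ℂ)ˣ) (y : (Fin d × Fin d) × B7Prop1Explicit.Site d) : uN n :=
  piU (MatrixLog.mlog ((cplaq L (bavg L V) ((L : ℤ) • y.2) y.1.1 y.1.2 : (Matrix n n ℂ)ˣ) : Matrix n n ℂ))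

/-- **Generation 10's `ΦA K · y x` for `U(N)`, valued in `V = u(N)`:** in the plane of `y` the torus transport
`π (textend …)` of `T4TermwiseTorus`; OFF the plane of `y` (where the kernel `pker` vanishes) simply `φ_U(x)`, so that
the norm identity `hΦA` holds for every pair. [folklore] -/
def PhiU (T L : ℕ) (V : B7Prop1Explicit.Site d → Fin d → (Matrix n n ℂ)ˣ) (y x : (Fin d × Fin d) × B7Prop1Explicit.Site d) : uN n :=
  if x.1 = y.1 then piU (textend T L y.1.1 y.1.2 ((L : ℤ) • y.2) (GM L V y) (phiM V y.1) x.2) else phiU V x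

/-- **`hΦA`/`hΦB` for `U(N)` (plane-labelled, one tower level):** for a `T`-periodic `U(N)`-valued configuration,
`‖Φ_U(y, x)‖ = ‖φ_U(x)‖` for EVERY coarse label `y` and EVERY fine label `x` — no smallness needed. [folklore] -/
theorem norm_PhiU (T L : ℕ) {V : B7Prop1Explicit.Site d → Fin d → (Matrix n n ℂ)ˣ} (hV : ∀ x κ, V x κ ∈ unitaryUnits (Matrix n n ℂ))
    (hper : IsPeriodic T V) (y x : (Fin d × Fin d) × B7Prop1Explicit.Site d) :
    ‖PhiU T L V y x‖ = ‖phiU V x‖ := by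
  unfold PhiU
  split_ifs with hx
  · rw [norm_piU_textend_transport T L y.1.1 y.1.2 ((L : ℤ) • y.2)
      ((L : ℤ) • y.2 + (L : ℤ) • e y.1.1 + (L : ℤ) • e y.1.2) hV hper _ rfl (phiM V y.1) rfl (GM L V y) rfl x.2,
      phiU, hx]
  · rfl

/-- **`hρA`/`hρB` for `U(N)` (plane-labelled, one tower level), the (bch) binder with values in `V = u(N)`:**
`‖ψ_U(y) − Σ_{x ∈ planes × [0,T)^d} pker(y, x) • Φ_U(y, x)‖ ≤ 280 θ²`, `θ = 8(d+1)(d+4)L²α₀`, for every coarse label `y`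
with plane in `planes` (all genuine), fine torus period `T ≥ 2L`. [folklore] -/
theorem bch_PhiU [Nonempty n] (T L : ℕ) (planes : Finset (Fin d × Fin d)) (hplanes : ∀ P ∈ planes, P.1 ≠ P.2)
    {V : B7Prop1Explicit.Site d → Fin d → (Matrix n n ℂ)ˣ} (hV : ∀ x κ, V x κ ∈ unitaryUnits (Matrix n n ℂ)) (hL : 1 ≤ L)
    (h2L : 2 * L ≤ T) {α₀ : ℝ} (hα₀ : 0 ≤ α₀) (hsmall : 512 * (d + 1) * (d + 4) * (L : ℝ) ^ 2 * α₀ ≤ 1)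
    (h44 : ∀ (x : B7Prop1Explicit.Site d) (κ κ' : Fin d), κ ≠ κ' → ‖((hol V x (plaqWord κ κ') : (Matrix n n ℂ)ˣ) : Matrix n n ℂ) - 1‖ ≤ α₀)
    (y : (Fin d × Fin d) × B7Prop1Explicit.Site d) (hy : y.1 ∈ planes) :
    ‖psiU L V y - ∑ x ∈ pbox planes T, pker T L y x • PhiU T L V y x‖
      ≤ 280 * (8 * (d + 1) * (d + 4) * (L : ℝ) ^ 2 * α₀) ^ 2 := by
  rw [pker_sum_eq T L planes hy (PhiU T L V y)]
  have hΦ : ∀ x : B7Prop1Explicit.Site d, PhiU T L V y (y.1, x)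
      = piU (textend T L y.1.1 y.1.2 ((L : ℤ) • y.2) (GM L V y) (phiM V y.1) x) := fun x => by
    simp only [PhiU, if_true]
  simp only [hΦ]
  exact bch_torus_piU T L y.1.1 y.1.2 hL h2L y.2 (hplanes _ hy) V hV hα₀ hsmall h44 _ rfl (phiM V y.1) rfl
    (GM L V y) rfl

/-- **The Wilson weights in `V = u(N)`** (representation binders `hreprU`/`hreprL` for `U(N)` with `e = eN`):
`1 − Re tr V(∂p_x) = e(φ_U(x))` and `1 − Re tr V̄(∂p′_y) = e(ψ_U(y))` under (44) with the Prop. 2 smallness.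
[cite: Balaban1985Averaging, (22)–(23) p.21] [cite: Balaban1987RG1, (0.2) p.252] -/
theorem wilson_phiU_psiU [Nonempty n] (L : ℕ) {V : B7Prop1Explicit.Site d → Fin d → (Matrix n n ℂ)ˣ}
    (hV : ∀ x κ, V x κ ∈ unitaryUnits (Matrix n n ℂ)) (hL : 1 ≤ L) {α₀ : ℝ} (hα₀ : 0 ≤ α₀)
    (hsmall : 512 * (d + 1) * (d + 4) * (L : ℝ) ^ 2 * α₀ ≤ 1)
    (h44 : ∀ (x : B7Prop1Explicit.Site d) (κ κ' : Fin d), κ ≠ κ' → ‖((hol V x (plaqWord κ κ') : (Matrix n n ℂ)ˣ) : Matrix n n ℂ) - 1‖ ≤ α₀)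
    (x y : (Fin d × Fin d) × B7Prop1Explicit.Site d) (hx : x.1.1 ≠ x.1.2) (hy : y.1.1 ≠ y.1.2) :
    1 - nReTr ((hol V x.2 (plaqWord x.1.1 x.1.2) : (Matrix n n ℂ)ˣ) : Matrix n n ℂ) = eN (phiU V x) ∧
      1 - nReTr ((cplaq L (bavg L V) ((L : ℤ) • y.2) y.1.1 y.1.2 : (Matrix n n ℂ)ˣ) : Matrix n n ℂ) = eN (psiU L V y) :=
  ⟨wilson_eq_eN (hol_mem_U hV x.2 _) ((norm_hol_sub_one_le hL hα₀ hsmall h44 hx x.2).trans (by norm_num)),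
    wilson_eq_eN (cplaq_mem_U L (bavg_mem_U hV L hL hα₀ hsmall h44) _ _ _)
      ((norm_cplaq_bavg_sub_one_le hV L hL hα₀ hsmall h44 _ hy).2.trans (by norm_num))⟩

/-- **(sz) for `U(N)`:** `‖φ_U(x)‖ ≤ 2α₀` and `‖ψ_U(y)‖ ≤ 2(L²α₀ + 226θ²)` under (44) with the Prop. 2 smallness
((20), (26), (44), Prop. 1 (51)). [cite: Balaban1985Averaging, (20) p.21, (26) p.22, Prop. 1 (51) p.26] -/
theorem norm_phiU_psiU_le [Nonempty n] (L : ℕ) {V : B7Prop1Explicit.Site d → Fin d → (Matrix n n ℂ)ˣ}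
    (hV : ∀ x κ, V x κ ∈ unitaryUnits (Matrix n n ℂ)) (hL : 1 ≤ L) {α₀ : ℝ} (hα₀ : 0 ≤ α₀)
    (hsmall : 512 * (d + 1) * (d + 4) * (L : ℝ) ^ 2 * α₀ ≤ 1)
    (h44 : ∀ (x : B7Prop1Explicit.Site d) (κ κ' : Fin d), κ ≠ κ' → ‖((hol V x (plaqWord κ κ') : (Matrix n n ℂ)ˣ) : Matrix n n ℂ) - 1‖ ≤ α₀)
    (x y : (Fin d × Fin d) × B7Prop1Explicit.Site d) (hx : x.1.1 ≠ x.1.2) (hy : y.1.1 ≠ y.1.2) :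
    ‖phiU V x‖ ≤ 2 * α₀ ∧
      ‖psiU L V y‖ ≤ 2 * ((L : ℝ) ^ 2 * α₀ + 226 * (8 * (d + 1) * (d + 4) * (L : ℝ) ^ 2 * α₀) ^ 2) := by
  have hf := norm_hol_sub_one_le hL hα₀ hsmall h44 hx x.2
  have hc := norm_cplaq_bavg_sub_one_le hV L hL hα₀ hsmall h44 ((L : ℤ) • y.2) hy
  refine ⟨(norm_piU_mlog_le (hf.trans (by norm_num))).trans ?_, (norm_piU_mlog_le (hc.2.trans (by norm_num))).trans ?_⟩
  · linarith [h44 x.2 _ _ hx]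
  · linarith [hc.1]

/-- The data are honest skew-hermitian matrices read in `HS n`: `φ_U(x) = log V(∂p_x)` and `ψ_U(y) = log V̄(∂p′_y)` as
vectors of `HS n` whenever the plaquette variables are within `1/4` of `1` ((22)–(23)); in particular
`‖φ_U(x)‖ = nhsNorm (log V(∂p_x))`. [cite: Balaban1985Averaging, (22)–(23) p.21] -/
theorem coe_phiU_eq {V : B7Prop1Explicit.Site d → Fin d → (Matrix n n ℂ)ˣ} (hV : ∀ x κ, V x κ ∈ unitaryUnits (Matrix n n ℂ))
    (x : (Fin d × Fin d) × B7Prop1Explicit.Site d) (h : ‖((hol V x.2 (plaqWord x.1.1 x.1.2) : (Matrix n n ℂ)ˣ) : Matrix n n ℂ) - 1‖ ≤ 1 / 4) :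
    ((phiU V x : uN n) : HS n) = toHS (phiM V x.1 x.2) ∧ ‖phiU V x‖ = nhsNorm (phiM V x.1 x.2) :=
  ⟨coe_piU_of_skew (mlog_skew (hol_mem_U hV x.2 _) h), norm_piU_of_skew (mlog_skew (hol_mem_U hV x.2 _) h)⟩

/-- (osc), SUPPORT, for `U(N)`: at two fine plaquettes of non-zero weight in the coarse plaquette `y`, the difference
`Φ_U(y, x) − Φ_U(y, x′)` is `π` of the difference of the transported window field at two slot positions of THAT window,
hence bounded in norm by its operator norm (`T4TermwiseTorus.osc_support`, (20)). The RATE (osc-U) itself is NOT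
PRINTED and not proved here. [folklore] -/
theorem norm_PhiU_sub_le (T L : ℕ) (V : B7Prop1Explicit.Site d → Fin d → (Matrix n n ℂ)ˣ)
    (y : (Fin d × Fin d) × B7Prop1Explicit.Site d) {x x' : B7Prop1Explicit.Site d}
    (hx : tker T L y.1.1 y.1.2 y.2 x ≠ 0) (hx' : tker T L y.1.1 y.1.2 y.2 x' ≠ 0) :
    ∃ s ∈ slots L, ∃ s' ∈ slots L,
      ‖PhiU T L V y (y.1, x) - PhiU T L V y (y.1, x')‖
        ≤ ‖GM L V y (zpos L y.1.1 y.1.2 ((L : ℤ) • y.2) s) - GM L V y (zpos L y.1.1 y.1.2 ((L : ℤ) • y.2) s')‖ := by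
  obtain ⟨s, hs, s', hs', h⟩ := osc_support T L y.1.1 y.1.2 (a := y.2) (fun x' => piU (n := n) (GM L V y x'))
    (fun x' => piU (phiM V y.1 x')) hx hx'
  refine ⟨s, hs, s', hs', ?_⟩
  have h1 : ∀ z : B7Prop1Explicit.Site d, PhiU T L V y (y.1, z)
      = textend T L y.1.1 y.1.2 ((L : ℤ) • y.2) (fun x' => piU (n := n) (GM L V y x')) (fun x' => piU (phiM V y.1 x')) z :=
    fun z => by simp only [PhiU, if_true, piU_textend]
  rw [h1, h1, h]
  exact norm_piU_sub_le _ _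

end Planes

/-! ## §7 Toys (non-vacuity) -/

section Toy

/-- Parallel transports of the constant configuration `1` are `1` (membership in the trivial subgroup). [folklore] -/
theorem hol_const_one {N d : ℕ} (x : B7Prop1Explicit.Site d) (w : List (Letter d)) :
    hol (fun (_ : B7Prop1Explicit.Site d) (_ : Fin d) => (1 : (Matrix (Fin N) (Fin N) ℂ)ˣ)) x w = 1 := by
  have h : hol (fun (_ : B7Prop1Explicit.Site d) (_ : Fin d) => (1 : (Matrix (Fin N) (Fin N) ℂ)ˣ)) x w
      ∈ (⊥ : Subgroup (Matrix (Fin N) (Fin N) ℂ)ˣ) :=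
    hol_mem_of (fun _ _ => Subgroup.mem_bot.2 rfl) x w
  rwa [Subgroup.mem_bot] at h

/-- Non-vacuity of `bch_PhiU` for `U(3)` (a group where the lineage's quaternion isometry is unavailable): the
constant configuration `1` on the two-dimensional torus of side `T = 4`, `L = 2`, meets every hypothesis with
`α₀ = 0`. [folklore] -/
example (planes : Finset (Fin 2 × Fin 2)) (hplanes : ∀ P ∈ planes, P.1 ≠ P.2)
    (y : (Fin 2 × Fin 2) × B7Prop1Explicit.Site 2) (hy : y.1 ∈ planes) :=
  bch_PhiU 4 2 planes hplanes (V := fun _ _ => (1 : (Matrix (Fin 3) (Fin 3) ℂ)ˣ)) (fun _ _ => Subgroup.one_mem _)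
    (by norm_num) (by norm_num) (α₀ := 0) le_rfl (by norm_num) (fun x κ κ' _ => by rw [hol_const_one]; simp) y hy

/-- Non-vacuity of `norm_PhiU` for `U(3)`: the same configuration is `4`-periodic. [folklore] -/
example (y x : (Fin 2 × Fin 2) × B7Prop1Explicit.Site 2) :=
  norm_PhiU 4 2 (V := fun _ _ => (1 : (Matrix (Fin 3) (Fin 3) ℂ)ˣ)) (fun _ _ => Subgroup.one_mem _) (fun _ _ => rfl) y x

/-- Non-vacuity of `wilson_eq_eN` for `U(3)`: at `U = 1` both sides are `0`. [folklore] -/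
example : 1 - nReTr ((1 : (Matrix (Fin 3) (Fin 3) ℂ)ˣ) : Matrix (Fin 3) (Fin 3) ℂ)
    = eN (piU (MatrixLog.mlog ((1 : (Matrix (Fin 3) (Fin 3) ℂ)ˣ) : Matrix (Fin 3) (Fin 3) ℂ))) :=
  wilson_eq_eN (Subgroup.one_mem _) (by simp)

/-- Non-vacuity of `eN_sandwich`: `u(3)` is inhabited and the sandwich holds at `0` (both sides `0`). [folklore] -/
example : ‖(0 : uN (Fin 3))‖ ^ 2 / 2 - (Fintype.card (Fin 3) : ℝ) / 24 * ‖(0 : uN (Fin 3))‖ ^ 4 ≤ eN (0 : uN (Fin 3)) :=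
  (eN_sandwich _).1

end Toy

end Literature.MathematicalPhysics.QuantumFieldTheory.Balaban1983to89.T4TermwiseUN

end
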